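import Summits.Ventures.QEC.Census.RankRREF
import HarnessLib

/-!
# Masks-only RREF rank certificates, CHUNKED form (plumbing for large check matrices)

`Census/RankRREF.lean` certifies `rank (rowMatrix n H) = r` from ONE Boolean check `rankRREFOKL n H r piv red masks`
(pivot columns, reduced rows, row-combination masks). For the 392 × 784 check matrices of the `[[784,24,≤24]]` code
(`Census/BB/BB784Data.lean`) the conjunct `masksOKL H red masks` — which recomputes every reduced row as the mask-selected
XOR of the rows of `H` (`xorMaskL`) — does not pass the gate as a single `decide +kernel`: measured on the farm
(qec-search-2 g4, 2026-08-27) the kernel time is ≈ 13 s for 100 reduced rows but ≈ 300 s for 200 and > 1 500 s for 380 in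
ONE kernel run (superlinear), while separate runs of ≤ 100 rows stay cheap. This file provides the two lemmas that let a
consumer split that conjunct (and, if needed, the row re-assembly conjunct) into CHUNKS proved by separate `decide +kernel`
theorems and re-assemble the certificate:

* `masksOKL_append` — `masksOKL H (r₁ ++ r₂) (k₁ ++ k₂) = (masksOKL H r₁ k₁ && masksOKL H r₂ k₂)` when `|r₁| = |k₁|`;
* `rank_rowMatrix_of_parts` — the rank conclusion from the four conjuncts supplied separately.
(Control: the 3 × 4 example `rank_control3` of `RankRREF.lean` is the same statement; not restated here.)

(`List.all_append` from Mathlib splits the row re-assembly conjunct `H.all …` when `H` is written as an append.)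
Everything PROVED; no definitions; axioms standard. HONEST FRAMING: plumbing only — certifies nothing by itself.
-/

namespace Summit.Ventures.QEC.Census

/-- **Chunking the mask check**: on equal-length prefixes, `masksOKL` of appended lists is the conjunction of the parts. -/
theorem masksOKL_append (H : List ℕ) : ∀ (r₁ k₁ r₂ k₂ : List ℕ), r₁.length = k₁.length →
    masksOKL H (r₁ ++ r₂) (k₁ ++ k₂) = (masksOKL H r₁ k₁ && masksOKL H r₂ k₂)
  | [], [], r₂, k₂, _ => by simp [masksOKL]
  | r :: rs, k :: ks, r₂, k₂, h => by
      simp only [List.cons_append, masksOKL, Bool.and_assoc]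
      rw [masksOKL_append H rs ks r₂ k₂ (by simpa using h)]
  | [], _ :: _, _, _, h => by simp at h
  | _ :: _, [], _, _, h => by simp at h

/-- **The rank from the four conjuncts of `rankRREFOKL` supplied separately** (so that each may be a separate — possibly
chunked — kernel computation): `rank (rowMatrix n H) = r`. -/
theorem rank_rowMatrix_of_parts {n : ℕ} {H : List ℕ} {r : ℕ} {piv red masks : List ℕ}
    (hr : (piv.length == r) = true) (hp : pivotsOK n piv red = true) (hm : masksOKL H red masks = true)
    (hs : (H.all fun h => redSelL piv red h == h) = true) : (rowMatrix n H).rank = r :=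
  rank_rowMatrix_of_rankRREFOKL (masks := masks) (by rw [rankRREFOKL, hr, hp, hm, hs]; rfl)

end Summit.Ventures.QEC.Census
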